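import Literature.NumberTheory.Transcendental.QuadraticRelationsLogarithmsBakerProofs
import Literature.NumberTheory.Transcendental.QuadraticRelationsLogarithmsBWProofs
import HarnessLib

/-!
# Quadratic relations between logarithms: isotropic ternary forms (PROVED)

Topic `Literature/NumberTheory/Transcendental`; fourth proofs-only sibling of
`QuadraticRelationsLogarithms.lean` (named facts
`Literature.NumberTheory.Transcendental.royWaldschmidt_quadratic_thm_0_2` = Roy–Waldschmidt 1997,
Théorème 0.2, and `Literature.NumberTheory.Transcendental.royWaldschmidt_quadraticForm_ne_zero_of_trdeg_one`
= the Résumé corollary), after `…Proofs.lean` (Résumé ⇐ Théorème 0.2), `…BWProofs.lean`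
(Brownawell–Waldschmidt cases: `X₁² − X₀X₂`, `X₀X₃ − X₁X₂`) and `…BakerProofs.lean` (Baker cases:
split forms, `n ≤ 2`).

Main result (`RoyWaldschmidt1997.quadraticForm_ne_zero_three_of_isotropic`): **the Résumé
corollary holds, in transcendence degree `≤ 1`, for every ternary quadratic form `Q ∈ ℚ[X₀,X₁,X₂]`
that is ISOTROPIC over `ℚ`** (has a non-trivial rational zero): if `λ₀, λ₁, λ₂` are `ℚ`-linearly
independent logarithms of algebraic numbers with `trdeg_ℚ ℚ(λ) ≤ 1`, then `Q(λ) ≠ 0`.  This is the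
classical reach (Baker + Brownawell–Waldschmidt, the case `d = ℓ = 2` of Roy–Waldschmidt's
Théorème 0.1, op. cit. p. 755; Roy–Waldschmidt 1995, Theorem 1) made explicit: after a rational
change of variables through the rational zero `v = (1, s, t)`, `Q = y₀'·y₂' + B'·y₁²` with
`ℚ`-linearly independent rational linear forms `y₀', y₁, y₂'`; if `B' = 0` the form splits over
`ℚ` (Baker, `…BakerProofs`); if `B' ≠ 0` a zero `Q(λ) = 0` makes the `2 × 2` matrix
`(B'y₁(λ), −y₀'(λ); y₂'(λ), y₁(λ))` of logarithms of algebraic numbers singular, so by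
`RoyWaldschmidt1997.not_linearIndependent_rows_or_cols` (Brownawell–Waldschmidt, `…BWProofs`) its
rows or its columns are `ℚ`-linearly dependent — a non-trivial `ℚ`-relation among `λ₀, λ₁, λ₂`.
So after this file the Résumé corollary is open classically exactly for the ANISOTROPIC ternary
forms (e.g. `X₀² + X₁² + X₂²`) and beyond, the genuinely new content of Théorème 0.2.

Also proved on the way: the coefficient expansion of a quadratic form
(`RoyWaldschmidt1997.aeval_eq_sum_sum_ite`, any `n`; `aeval_eq_of_isHomogeneous_two_three`).
No definitions, no named facts (D-0026).

## References

* [RoyWaldschmidt1997ENS] D. Roy, M. Waldschmidt, *Approximation diophantienne et indépendance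
  algébrique de logarithmes*, Ann. Sci. ÉNS (4) 30 (1997) 753–796: Résumé p. 753, Théorème 0.1
  (case `d = ℓ = 2` = Brownawell–Waldschmidt) and Théorème 0.2, p. 755
  (lit key paper:doi-10-1016-s0012-9593-97-89938-7, PDF pp. 2, 4).
* [RoyWaldschmidt1995] D. Roy, M. Waldschmidt, *Quadratic relations between logarithms of algebraic
  numbers*, Proc. Japan Acad. 71A (1995) 151–153, Theorem 1.
* [Baker1975] A. Baker, *Transcendental Number Theory*, CUP 1975, Thm. 2.1 (tree: `baker_holds`).
-/

noncomputable section

open Complex IntermediateField MvPolynomial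

namespace Literature.NumberTheory.Transcendental

namespace RoyWaldschmidt1997

variable {n : ℕ}

/-! ### The coefficient expansion of a quadratic form -/

/-- An exponent vector of degree `2` is `eᵢ + eⱼ` with `i ≤ j`. [folklore] -/
theorem exists_le_and_eq_single_add_single {d : Fin n →₀ ℕ} (hd : d.degree = 2) :
    ∃ i j : Fin n, i ≤ j ∧ d = Finsupp.single i 1 + Finsupp.single j 1 := by
  classical
  have hcard : Multiset.card (Finsupp.toMultiset d) = 2 := by
    rw [Finsupp.card_toMultiset, ← hd, Finsupp.degree_apply]
    rfl
  obtain ⟨x, y, hxy⟩ := Multiset.card_eq_two.mp hcard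
  have hd' : d = Finsupp.single x 1 + Finsupp.single y 1 := by
    rw [← Finsupp.toMultiset_toFinsupp d, hxy, Multiset.insert_eq_cons, ← Multiset.singleton_add,
      Multiset.toFinsupp_add, Multiset.toFinsupp_singleton, Multiset.toFinsupp_singleton]
  rcases le_total x y with h | h
  · exact ⟨x, y, h, hd'⟩
  · exact ⟨y, x, h, by rw [hd', add_comm]⟩

/-- `eᵢ + eⱼ` determines the pair `i ≤ j`. [folklore] -/
theorem single_add_single_inj {i j i' j' : Fin n} (hij : i ≤ j) (hij' : i' ≤ j')
    (h : Finsupp.single i 1 + Finsupp.single j 1 =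
      (Finsupp.single i' 1 + Finsupp.single j' 1 : Fin n →₀ ℕ)) :
    i = i' ∧ j = j' := by
  have hm : ({i, j} : Multiset (Fin n)) = {i', j'} := by
    have := congrArg Finsupp.toMultiset h
    simpa only [Finsupp.toMultiset_add, Finsupp.toMultiset_single, one_nsmul,
      Multiset.insert_eq_cons, Multiset.singleton_add] using this
  have h1 : i ∈ ({i', j'} : Multiset (Fin n)) := hm ▸ (by simp)
  have h2 : j ∈ ({i', j'} : Multiset (Fin n)) := hm ▸ (by simp)
  have h3 : i' ∈ ({i, j} : Multiset (Fin n)) := hm.symm ▸ (by simp)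
  have h4 : j' ∈ ({i, j} : Multiset (Fin n)) := hm.symm ▸ (by simp)
  simp only [Multiset.insert_eq_cons, Multiset.mem_cons, Multiset.mem_singleton] at h1 h2 h3 h4
  simp only [Fin.ext_iff, Fin.le_def] at *
  omega

/-- The monomial `z^{eᵢ + eⱼ} = zᵢ zⱼ`. [folklore] -/
theorem prod_pow_single_add_single {A : Type*} [CommMonoid A] (z : Fin n → A) (i j : Fin n) :
    ∏ k, z k ^ ((Finsupp.single i 1 : Fin n →₀ ℕ) k + (Finsupp.single j 1 : Fin n →₀ ℕ) k) =
      z i * z j := by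
  classical
  have h1 : ∀ i : Fin n, ∏ k, z k ^ (Finsupp.single i 1 : Fin n →₀ ℕ) k = z i := by
    intro i
    rw [Finset.prod_eq_single i]
    · simp
    · intro k _ hk
      simp [Ne.symm hk]
    · simp
  simp only [pow_add, Finset.prod_mul_distrib, h1]

/-- **Coefficient expansion of a quadratic form**: for `Q ∈ ℚ[X₁,…,Xₙ]` homogeneous of degree `2`
and a point `z` of a commutative `ℚ`-algebra, `Q(z) = ∑_{i ≤ j} q_{ij} zᵢ zⱼ` with
`q_{ij} = coeff_{XᵢXⱼ} Q`. [folklore] -/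
theorem aeval_eq_sum_sum_ite {A : Type*} [CommRing A] [Algebra ℚ A] (Q : MvPolynomial (Fin n) ℚ)
    (hQ : Q.IsHomogeneous 2) (z : Fin n → A) :
    aeval z Q = ∑ i, ∑ j, if i ≤ j then
      algebraMap ℚ A (Q.coeff (Finsupp.single i 1 + Finsupp.single j 1)) * (z i * z j) else 0 := by
  classical
  set P : Finset (Fin n × Fin n) := Finset.univ.filter (fun p => p.1 ≤ p.2) with hP
  set φ : Fin n × Fin n → (Fin n →₀ ℕ) := fun p => Finsupp.single p.1 1 + Finsupp.single p.2 1
    with hφ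
  set G : (Fin n →₀ ℕ) → A := fun d => algebraMap ℚ A (Q.coeff d) * ∏ k, z k ^ d k with hG
  have hR : (∑ i, ∑ j, if i ≤ j then
      algebraMap ℚ A (Q.coeff (Finsupp.single i 1 + Finsupp.single j 1)) * (z i * z j) else 0) =
      ∑ p ∈ P, G (φ p) := by
    rw [hP, Finset.sum_filter, ← Finset.univ_product_univ, Finset.sum_product]
    refine Finset.sum_congr rfl fun i _ => Finset.sum_congr rfl fun j _ => ?_
    split_ifs
    · simp only [hG, hφ, Finsupp.coe_add, Pi.add_apply, prod_pow_single_add_single]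
    · rfl
  have hinj : Set.InjOn φ P := by
    rintro ⟨i, j⟩ hp ⟨i', j'⟩ hp' h
    simp only [hP, Finset.coe_filter, Finset.mem_univ, true_and, Set.mem_setOf_eq] at hp hp'
    obtain ⟨h1, h2⟩ := single_add_single_inj hp hp' h
    rw [h1, h2]
  have hsupp : Q.support ⊆ P.image φ := by
    intro d hd
    obtain ⟨i, j, hij, rfl⟩ := exists_le_and_eq_single_add_single (degree_eq_two_of_mem_support hQ hd)
    exact Finset.mem_image.mpr ⟨(i, j), by simp [hP, hij], rfl⟩
  have hL : aeval z Q = ∑ d ∈ Q.support, G d := by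
    rw [MvPolynomial.aeval_def, MvPolynomial.eval₂_eq']
  rw [hR, hL, Finset.sum_subset hsupp (fun d _ hd => by simp [hG, notMem_support_iff.mp hd]),
    Finset.sum_image hinj]

/-- **A ternary quadratic form in coordinates**:
`Q(z) = a z₀² + b z₁² + c z₂² + d z₀z₁ + e z₀z₂ + f z₁z₂` with `a, …, f` the coefficients of
`X₀², X₁², X₂², X₀X₁, X₀X₂, X₁X₂`. [folklore] -/
theorem aeval_eq_of_isHomogeneous_two_three {A : Type*} [CommRing A] [Algebra ℚ A]
    (Q : MvPolynomial (Fin 3) ℚ) (hQ : Q.IsHomogeneous 2) (z : Fin 3 → A) :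
    aeval z Q =
      algebraMap ℚ A (Q.coeff (Finsupp.single 0 2)) * z 0 ^ 2 +
      algebraMap ℚ A (Q.coeff (Finsupp.single 1 2)) * z 1 ^ 2 +
      algebraMap ℚ A (Q.coeff (Finsupp.single 2 2)) * z 2 ^ 2 +
      algebraMap ℚ A (Q.coeff (Finsupp.single 0 1 + Finsupp.single 1 1)) * (z 0 * z 1) +
      algebraMap ℚ A (Q.coeff (Finsupp.single 0 1 + Finsupp.single 2 1)) * (z 0 * z 2) +
      algebraMap ℚ A (Q.coeff (Finsupp.single 1 1 + Finsupp.single 2 1)) * (z 1 * z 2) := by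
  have e2 : ∀ i : Fin 3, (Finsupp.single i 1 + Finsupp.single i 1 : Fin 3 →₀ ℕ) =
      Finsupp.single i 2 := fun i => by
    rw [← Finsupp.single_add]
  rw [aeval_eq_sum_sum_ite Q hQ z]
  simp only [Fin.sum_univ_three, Fin.isValue, le_refl, if_true, e2]
  have h10 : ¬ ((1 : Fin 3) ≤ 0) := by decide
  have h20 : ¬ ((2 : Fin 3) ≤ 0) := by decide
  have h21 : ¬ ((2 : Fin 3) ≤ 1) := by decide
  have h01 : ((0 : Fin 3) ≤ 1) := by decide
  have h02 : ((0 : Fin 3) ≤ 2) := by decide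
  have h12 : ((1 : Fin 3) ≤ 2) := by decide
  simp only [h10, h20, h21, h01, h02, h12, if_true, if_false]
  ring

/-! ### Rational relations and products of algebraic linear forms -/

/-- A rational relation among `ℚ`-linearly independent `λ₀, λ₁, λ₂` is trivial. [folklore] -/
theorem rat_coeff_eq_zero {l : Fin 3 → ℂ} (hli : LinearIndependent ℚ l) (c : Fin 3 → ℚ)
    (h : (c 0 : ℂ) * l 0 + c 1 * l 1 + c 2 * l 2 = 0) : c 0 = 0 ∧ c 1 = 0 ∧ c 2 = 0 := by
  have hcoef := Fintype.linearIndependent_iff.mp hli c (by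
    simpa [Fin.sum_univ_three, Rat.smul_def] using h)
  exact ⟨hcoef 0, hcoef 1, hcoef 2⟩

/-- Baker: a product of two non-zero linear forms with algebraic coefficients does not vanish at
`ℚ`-linearly independent logarithms of algebraic numbers. [cite: Baker1975, Thm 2.1] -/
theorem sum_mul_sum_ne_zero {l : Fin n → ℂ} (hl : ∀ i, IsAlgebraic ℚ (cexp (l i)))
    (hli : LinearIndependent ℚ l) {a b : Fin n → ℂ} (ha : ∀ i, IsAlgebraic ℚ (a i))
    (hb : ∀ i, IsAlgebraic ℚ (b i)) (ha0 : a ≠ 0) (hb0 : b ≠ 0) :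
    (∑ i, a i * l i) * (∑ i, b i * l i) ≠ 0 :=
  mul_ne_zero (fun h => ha0 (eq_zero_of_sum_algebraic_mul_eq_zero hl hli ha h))
    (fun h => hb0 (eq_zero_of_sum_algebraic_mul_eq_zero hl hli hb h))

/-- Rational numbers are algebraic. [folklore] -/
theorem isAlgebraic_ratCast (x : ℚ) : IsAlgebraic ℚ (x : ℂ) := by
  simpa using isAlgebraic_algebraMap (R := ℚ) (A := ℂ) x

/-- **A binary quadratic form `p y₀² + q y₀y₁ + r y₁²` over `ℚ`, not identically zero, is a product
of two NON-ZERO linear forms with algebraic coefficients.** [folklore] -/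
theorem exists_split_binary (p q r : ℚ) (h : ¬ (p = 0 ∧ q = 0 ∧ r = 0)) :
    ∃ a b : Fin 2 → ℂ, (∀ i, IsAlgebraic ℚ (a i)) ∧ (∀ i, IsAlgebraic ℚ (b i)) ∧ a ≠ 0 ∧ b ≠ 0 ∧
      ∀ y₀ y₁ : ℂ, (p : ℂ) * y₀ ^ 2 + q * (y₀ * y₁) + r * y₁ ^ 2 =
        (a 0 * y₀ + a 1 * y₁) * (b 0 * y₀ + b 1 * y₁) := by
  have hK : ∀ x : ℚ, (x : ℂ) ∈ algebraicClosure ℚ ℂ := fun x =>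
    mem_algebraicClosure_iff.2 (isAlgebraic_ratCast x)
  by_cases hp0 : p = 0
  · -- `Q = y₁ (q y₀ + r y₁)`
    refine ⟨![0, 1], ![(q : ℂ), (r : ℂ)], ?_, ?_, ?_, ?_, fun y₀ y₁ => ?_⟩
    · intro i; fin_cases i
      · simpa using isAlgebraic_zero
      · simpa using isAlgebraic_one
    · intro i; fin_cases i <;> simpa using isAlgebraic_ratCast _
    · intro h0
      have := congrFun h0 1
      simp at this
    · intro h0
      have h0' := congrFun h0 0
      have h1' := congrFun h0 1
      simp only [Matrix.cons_val_zero, Matrix.cons_val_one, Pi.zero_apply, Rat.cast_eq_zero] at h0' h1'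
      exact h ⟨hp0, h0', h1'⟩
    · rw [hp0]
      simp
      ring
  · -- `4pQ = (2p y₀ + (q − s) y₁)(2p y₀ + (q + s) y₁)`, `s² = q² − 4pr`
    obtain ⟨s, hs⟩ := IsAlgClosed.exists_pow_nat_eq ((q : ℂ) ^ 2 - 4 * p * r) two_pos
    have hsalg : IsAlgebraic ℚ s := by
      refine IsAlgebraic.of_pow two_pos ?_
      rw [hs]
      have h' := isAlgebraic_ratCast (q ^ 2 - 4 * p * r)
      push_cast at h'
      exact h'
    have hpC : (p : ℂ) ≠ 0 := by exact_mod_cast hp0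
    set c : ℂ := (((4 * p)⁻¹ : ℚ) : ℂ) with hc_def
    have hc : 4 * (p : ℂ) * c = 1 := by
      rw [hc_def]
      push_cast
      field_simp
    have hc0 : c ≠ 0 := by
      intro h0
      rw [h0, mul_zero] at hc
      exact zero_ne_one hc
    have hsK : s ∈ algebraicClosure ℚ ℂ := mem_algebraicClosure_iff.2 hsalg
    have hcK : c ∈ algebraicClosure ℚ ℂ := hK _
    refine ⟨![2 * (p : ℂ), (q : ℂ) - s], ![2 * (p : ℂ) * c, ((q : ℂ) + s) * c], ?_, ?_, ?_, ?_,
      fun y₀ y₁ => ?_⟩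
    · intro i; fin_cases i
      · simpa using isAlgebraic_ratCast (2 * p)
      · simpa using mem_algebraicClosure_iff.1 (sub_mem (hK q) hsK)
    · intro i; fin_cases i
      · have h2p : (2 : ℂ) * p ∈ algebraicClosure ℚ ℂ := by simpa using hK (2 * p)
        simpa using mem_algebraicClosure_iff.1 (mul_mem h2p hcK)
      · simpa using mem_algebraicClosure_iff.1 (mul_mem (add_mem (hK q) hsK) hcK)
    · intro h0
      have := congrFun h0 0
      simp only [Matrix.cons_val_zero, Pi.zero_apply, mul_eq_zero] at this
      rcases this with h2 | h2
      · norm_num at h2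
      · exact hpC h2
    · intro h0
      have := congrFun h0 0
      simp only [Matrix.cons_val_zero, Pi.zero_apply, mul_eq_zero] at this
      rcases this with (h2 | h2) | h2
      · norm_num at h2
      · exact hpC h2
      · exact hc0 h2
    · simp only [Matrix.cons_val_zero, Matrix.cons_val_one]
      linear_combination (-((p : ℂ) * y₀ ^ 2 + (q : ℂ) * (y₀ * y₁) + (r : ℂ) * y₁ ^ 2)) * hc +
        c * y₁ ^ 2 * hs

/-! ### The ternary case through a rational zero `(1, s, t)` -/

/-- Core step. Let `Q = a X₀² + b X₁² + c X₂² + d X₀X₁ + e X₀X₂ + f X₁X₂ ∈ ℚ[X]` vanish at the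
rational point `(1, s, t)` and assume `e' := e + f s + 2 c t ≠ 0`. Then `Q(λ) ≠ 0` for
`ℚ`-linearly independent logarithms of algebraic numbers `λ₀, λ₁, λ₂` with `trdeg ℚ(λ) ≤ 1`.
In the coordinates `y₁ = z₁ − s z₀`, `y₂ = z₂ − t z₀`, `y₂' = d' y₁ + e' y₂` (`d' = d + 2bs + ft`),
`y₀' = z₀ + F' y₁ + C' y₂'` one has `Q = y₀' y₂' + B' y₁²`; `B' = 0`: Baker; `B' ≠ 0`: the matrix
`(B'y₁, −y₀'; y₂', y₁)` at `λ` is singular when `Q(λ) = 0`, and Brownawell–Waldschmidt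
(`not_linearIndependent_rows_or_cols`) makes its rows or columns `ℚ`-dependent, contradicting the
independence of `λ`. [cite: RoyWaldschmidt1997ENS, Théorème 0.1 (d = ℓ = 2) p. 755; Résumé p. 753]
[cite: RoyWaldschmidt1995, Theorem 1] -/
theorem ternary_core_e (a b c d e f s t : ℚ)
    (hv : a + b * s ^ 2 + c * t ^ 2 + d * s + e * t + f * (s * t) = 0)
    (he : e + f * s + 2 * c * t ≠ 0)
    {l : Fin 3 → ℂ} (hl : ∀ i, IsAlgebraic ℚ (cexp (l i))) (hli : LinearIndependent ℚ l)
    (ht : ¬ (2 : Cardinal) ≤ Algebra.trdeg ℚ ↥(adjoin ℚ (Set.range l))) :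
    (a : ℂ) * l 0 ^ 2 + b * l 1 ^ 2 + c * l 2 ^ 2 + d * (l 0 * l 1) + e * (l 0 * l 2) +
      f * (l 1 * l 2) ≠ 0 := by
  -- the new parameters (fresh rational variables with their defining equations)
  obtain ⟨d', hd'⟩ : ∃ d' : ℚ, d' = d + 2 * b * s + f * t := ⟨_, rfl⟩
  obtain ⟨e', he'⟩ : ∃ e' : ℚ, e' = e + f * s + 2 * c * t := ⟨_, rfl⟩
  have he0 : e' ≠ 0 := he' ▸ he
  obtain ⟨C', hC'⟩ : ∃ C' : ℚ, C' * e' ^ 2 = c := ⟨c / e' ^ 2, by field_simp⟩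
  obtain ⟨F', hF'⟩ : ∃ F' : ℚ, F' * e' ^ 2 = f * e' - 2 * c * d' :=
    ⟨(f * e' - 2 * c * d') / e' ^ 2, by field_simp⟩
  obtain ⟨B', hB'⟩ : ∃ B' : ℚ, B' * e' ^ 2 = b * e' ^ 2 - f * d' * e' + c * d' ^ 2 :=
    ⟨(b * e' ^ 2 - f * d' * e' + c * d' ^ 2) / e' ^ 2, by field_simp⟩
  -- the linear forms at `λ`
  set y₁ : ℂ := l 1 - s * l 0 with hy₁
  set y₂ : ℂ := l 2 - t * l 0 with hy₂
  set y₂' : ℂ := d' * y₁ + e' * y₂ with hy₂'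
  set y₀' : ℂ := l 0 + F' * y₁ + C' * y₂' with hy₀'
  have hvC : (a : ℂ) + b * s ^ 2 + c * t ^ 2 + d * s + e * t + f * (s * t) = 0 := by
    exact_mod_cast hv
  have hdC : (d' : ℂ) = d + 2 * b * s + f * t := by exact_mod_cast hd'
  have heC : (e' : ℂ) = e + f * s + 2 * c * t := by exact_mod_cast he'
  have hCC : (C' : ℂ) * e' ^ 2 = c := by exact_mod_cast hC'
  have hFC : (F' : ℂ) * e' ^ 2 = f * e' - 2 * c * d' := by exact_mod_cast hF'
  have hBC : (B' : ℂ) * e' ^ 2 = b * e' ^ 2 - f * d' * e' + c * d' ^ 2 := by exact_mod_cast hB'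
  have he0C : (e' : ℂ) ≠ 0 := by exact_mod_cast he0
  -- (I1): `Q(λ) = λ₀ (d' y₁ + e' y₂) + (b y₁² + f y₁ y₂ + c y₂²)`
  have hI1 : (a : ℂ) * l 0 ^ 2 + b * l 1 ^ 2 + c * l 2 ^ 2 + d * (l 0 * l 1) + e * (l 0 * l 2) +
      f * (l 1 * l 2) = l 0 * (d' * y₁ + e' * y₂) + (b * y₁ ^ 2 + f * (y₁ * y₂) + c * y₂ ^ 2) := by
    rw [hy₁, hy₂]
    linear_combination (l 0) ^ 2 * hvC - (l 0 * (l 1 - s * l 0)) * hdC -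
      (l 0 * (l 2 - t * l 0)) * heC
  -- (I2): `… = y₀' y₂' + B' y₁²` (an identity, multiplied by `e'² ≠ 0`)
  have hI2 : l 0 * (d' * y₁ + e' * y₂) + (b * y₁ ^ 2 + f * (y₁ * y₂) + c * y₂ ^ 2) =
      y₀' * y₂' + B' * y₁ ^ 2 := by
    have h2 : (e' : ℂ) ^ 2 ≠ 0 := pow_ne_zero 2 he0C
    refine mul_left_cancel₀ h2 ?_
    rw [hy₀', hy₂']
    linear_combination (-(y₁ * (d' * y₁ + e' * y₂))) * hFC -
      (d' * y₁ + e' * y₂) ^ 2 * hCC - y₁ ^ 2 * hBC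
  rw [hI1, hI2]
  -- the coefficient vectors of `y₁, y₂', y₀'` as rational linear forms in `λ`
  have hy₁s : y₁ = ∑ k, ((![-s, 1, 0] : Fin 3 → ℚ) k : ℂ) * l k := by
    simp [Fin.sum_univ_three, hy₁]; ring
  have hy₂s : y₂' = ∑ k, ((![-(d' * s + e' * t), d', e'] : Fin 3 → ℚ) k : ℂ) * l k := by
    simp [Fin.sum_univ_three, hy₂', hy₁, hy₂]; ring
  have hy₀s : y₀' =
      ∑ k, ((![1 - F' * s - C' * (d' * s + e' * t), F' + C' * d', C' * e'] : Fin 3 → ℚ) k : ℂ) *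
        l k := by
    simp [Fin.sum_univ_three, hy₀', hy₂', hy₁, hy₂]; ring
  intro h0
  by_cases hB0 : B' = 0
  · -- `Q = y₀' · y₂'`: Baker
    have hprod : y₀' * y₂' = 0 := by
      rw [hB0, Rat.cast_zero, zero_mul, add_zero] at h0
      exact h0
    rw [hy₀s, hy₂s] at hprod
    refine sum_mul_sum_ne_zero hl hli (fun i => isAlgebraic_ratCast _)
      (fun i => isAlgebraic_ratCast _) ?_ ?_ hprod
    · -- `y₀' ≠ 0` as a form: its value at `(1, s, t)` is `1`
      intro hz
      have hz0 := congrFun hz 0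
      have hz1 := congrFun hz 1
      have hz2 := congrFun hz 2
      simp only [Matrix.cons_val_zero, Matrix.cons_val_one, Matrix.cons_val, Pi.zero_apply,
        Rat.cast_eq_zero] at hz0 hz1 hz2
      have key : (1 - F' * s - C' * (d' * s + e' * t)) + (F' + C' * d') * s + (C' * e') * t = 1 := by
        ring
      rw [hz0, hz1, hz2] at key
      norm_num at key
    · intro hz
      have hz2 := congrFun hz 2
      simp only [Matrix.cons_val, Pi.zero_apply, Rat.cast_eq_zero] at hz2
      exact he0 hz2
  · -- `B' ≠ 0`: the singular matrix `(B' y₁, -y₀'; y₂', y₁)`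
    have hB0C : (B' : ℂ) ≠ 0 := by exact_mod_cast hB0
    let M : Matrix (Fin 2) (Fin 2) ℂ := !![(B' : ℂ) * y₁, -y₀'; y₂', y₁]
    -- entries as rational linear forms in `λ`
    have hM00 : M 0 0 = ∑ k, ((![-(B' * s), B', 0] : Fin 3 → ℚ) k : ℂ) * l k := by
      simp [M, Fin.sum_univ_three, hy₁]; ring
    have hM01 : M 0 1 =
        ∑ k, ((![-(1 - F' * s - C' * (d' * s + e' * t)), -(F' + C' * d'), -(C' * e')] :
          Fin 3 → ℚ) k : ℂ) * l k := by
      simp [M, Fin.sum_univ_three, hy₀', hy₂', hy₁, hy₂]; ring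
    have hM10 : M 1 0 = ∑ k, ((![-(d' * s + e' * t), d', e'] : Fin 3 → ℚ) k : ℂ) * l k := by
      simp [M, Fin.sum_univ_three, hy₂', hy₁, hy₂]; ring
    have hM11 : M 1 1 = ∑ k, ((![-s, 1, 0] : Fin 3 → ℚ) k : ℂ) * l k := by
      simp [M, Fin.sum_univ_three, hy₁]; ring
    have hsumL : ∀ cf : Fin 3 → ℚ, IsAlgebraic ℚ (cexp (∑ k, ((cf k : ℚ) : ℂ) * l k)) :=
      fun cf => isAlgebraic_cexp_sum_rat_mul hl cf
    have hsumK : ∀ cf : Fin 3 → ℚ, (∑ k, ((cf k : ℚ) : ℂ) * l k) ∈ adjoin ℚ (Set.range l) := by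
      intro cf
      refine sum_mem fun k _ => mul_mem ?_ (subset_adjoin ℚ _ ⟨k, rfl⟩)
      exact (adjoin ℚ (Set.range l)).algebraMap_mem (cf k)
    have hM : ∀ i j, IsAlgebraic ℚ (cexp (M i j)) := by
      refine Fin.forall_fin_two.mpr ⟨Fin.forall_fin_two.mpr ⟨?_, ?_⟩, Fin.forall_fin_two.mpr ⟨?_, ?_⟩⟩
      · rw [hM00]; exact hsumL _
      · rw [hM01]; exact hsumL _
      · rw [hM10]; exact hsumL _
      · rw [hM11]; exact hsumL _
    have hMK : ∀ i j, M i j ∈ adjoin ℚ (Set.range l) := by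
      refine Fin.forall_fin_two.mpr ⟨Fin.forall_fin_two.mpr ⟨?_, ?_⟩, Fin.forall_fin_two.mpr ⟨?_, ?_⟩⟩
      · rw [hM00]; exact hsumK _
      · rw [hM01]; exact hsumK _
      · rw [hM10]; exact hsumK _
      · rw [hM11]; exact hsumK _
    have hdet : M 0 0 * M 1 1 = M 0 1 * M 1 0 := by
      show ((B' : ℂ) * y₁) * y₁ = (-y₀') * y₂'
      linear_combination h0
    have hK : adjoin ℚ (Set.range fun p : Fin 2 × Fin 2 => M p.1 p.2) ≤ adjoin ℚ (Set.range l) := by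
      refine adjoin_le_iff.mpr ?_
      rintro _ ⟨⟨i, j⟩, rfl⟩
      exact hMK i j
    have ht' : ¬ (2 : Cardinal) ≤
        Algebra.trdeg ℚ ↥(adjoin ℚ (Set.range fun p : Fin 2 × Fin 2 => M p.1 p.2)) :=
      fun h2 => ht (h2.trans (trdeg_le_of_injective (inclusion hK) (inclusion_injective hK)))
    rcases not_linearIndependent_rows_or_cols M hM hdet ht' with hr | hc
    · -- rows dependent: look at the first column `(B' y₁, y₂')`
      obtain ⟨g, hg, i₀, hi₀⟩ := Fintype.not_linearIndependent_iff.mp hr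
      have h0c : (g 0 : ℂ) * (B' * y₁) + g 1 * y₂' = 0 := by
        have := congrFun hg 0
        simpa [M, Fin.sum_univ_two, Rat.smul_def] using this
      have hrel : ((-(g 0 * B' * s) - g 1 * (d' * s + e' * t) : ℚ) : ℂ) * l 0 +
          ((g 0 * B' + g 1 * d' : ℚ) : ℂ) * l 1 + ((g 1 * e' : ℚ) : ℂ) * l 2 = 0 := by
        rw [hy₂', hy₁, hy₂] at h0c
        push_cast
        linear_combination h0c
      obtain ⟨-, h1, h2⟩ := rat_coeff_eq_zero hli
        ![-(g 0 * B' * s) - g 1 * (d' * s + e' * t), g 0 * B' + g 1 * d', g 1 * e']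
        (by simpa only [Matrix.cons_val_zero, Matrix.cons_val_one, Matrix.cons_val] using hrel)
      simp only [Matrix.cons_val_one, Matrix.cons_val, Matrix.cons_val_zero] at h1 h2
      have hg1 : g 1 = 0 := by
        rcases mul_eq_zero.mp h2 with h | h
        · exact h
        · exact absurd h he0
      have hg0 : g 0 = 0 := by
        rw [hg1, zero_mul, add_zero] at h1
        rcases mul_eq_zero.mp h1 with h | h
        · exact h
        · exact absurd h hB0
      apply hi₀
      fin_cases i₀
      · exact hg0
      · exact hg1
    · -- columns dependent: look at the second row `(y₂', y₁)`
      obtain ⟨g, hg, i₀, hi₀⟩ := Fintype.not_linearIndependent_iff.mp hc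
      have h1c : (g 0 : ℂ) * y₂' + g 1 * y₁ = 0 := by
        have := congrFun hg 1
        simpa [M, Fin.sum_univ_two, Rat.smul_def, Matrix.transpose_apply] using this
      have hrel : ((-(g 0 * (d' * s + e' * t)) - g 1 * s : ℚ) : ℂ) * l 0 +
          ((g 0 * d' + g 1 : ℚ) : ℂ) * l 1 + ((g 0 * e' : ℚ) : ℂ) * l 2 = 0 := by
        rw [hy₂', hy₁, hy₂] at h1c
        push_cast
        linear_combination h1c
      obtain ⟨-, h1, h2⟩ := rat_coeff_eq_zero hli
        ![-(g 0 * (d' * s + e' * t)) - g 1 * s, g 0 * d' + g 1, g 0 * e']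
        (by simpa only [Matrix.cons_val_zero, Matrix.cons_val_one, Matrix.cons_val] using hrel)
      simp only [Matrix.cons_val_one, Matrix.cons_val, Matrix.cons_val_zero] at h1 h2
      have hg0 : g 0 = 0 := by
        rcases mul_eq_zero.mp h2 with h | h
        · exact h
        · exact absurd h he0
      have hg1 : g 1 = 0 := by
        rw [hg0, zero_mul, zero_add] at h1
        exact h1
      apply hi₀
      fin_cases i₀
      · exact hg0
      · exact hg1

/-- The ternary case through a rational zero `(1, s, t)`, all positions of `e'`: if
`Q = a X₀² + ⋯ + f X₁X₂ ≠ 0` vanishes at `(1, s, t) ∈ ℚ³` then `Q(λ) ≠ 0` (`trdeg ℚ(λ) ≤ 1`).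
Cases: `e' ≠ 0` (`ternary_core_e`); `e' = 0 ≠ d'` (the same with `X₁ ↔ X₂`); `d' = e' = 0`:
`Q` is a binary form in `y₁, y₂`, split over `ℚ̄` (Baker).
[cite: RoyWaldschmidt1997ENS, Résumé p. 753; Théorème 0.1 (d = ℓ = 2) p. 755] -/
theorem ternary_core (a b c d e f s t : ℚ)
    (hv : a + b * s ^ 2 + c * t ^ 2 + d * s + e * t + f * (s * t) = 0)
    (hne : ¬ (a = 0 ∧ b = 0 ∧ c = 0 ∧ d = 0 ∧ e = 0 ∧ f = 0))
    {l : Fin 3 → ℂ} (hl : ∀ i, IsAlgebraic ℚ (cexp (l i))) (hli : LinearIndependent ℚ l)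
    (ht : ¬ (2 : Cardinal) ≤ Algebra.trdeg ℚ ↥(adjoin ℚ (Set.range l))) :
    (a : ℂ) * l 0 ^ 2 + b * l 1 ^ 2 + c * l 2 ^ 2 + d * (l 0 * l 1) + e * (l 0 * l 2) +
      f * (l 1 * l 2) ≠ 0 := by
  by_cases he : e + f * s + 2 * c * t ≠ 0
  · exact ternary_core_e a b c d e f s t hv he hl hli ht
  rw [not_ne_iff] at he
  by_cases hd : d + f * t + 2 * b * s ≠ 0
  · -- swap the coordinates `1` and `2`
    set σ : Equiv.Perm (Fin 3) := Equiv.swap 1 2 with hσ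
    have hv' : a + c * t ^ 2 + b * s ^ 2 + e * t + d * s + f * (t * s) = 0 := by
      linear_combination hv
    have hl' : ∀ i, IsAlgebraic ℚ (cexp ((l ∘ σ) i)) := fun i => hl _
    have hli' : LinearIndependent ℚ (l ∘ σ) := hli.comp _ σ.injective
    have ht' : ¬ (2 : Cardinal) ≤ Algebra.trdeg ℚ ↥(adjoin ℚ (Set.range (l ∘ σ))) := by
      rwa [σ.surjective.range_comp]
    have key := ternary_core_e a c b e d f t s hv' hd hl' hli' ht'
    have h0 : (l ∘ σ) 0 = l 0 := by simp [hσ, Equiv.swap_apply_of_ne_of_ne]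
    have h1 : (l ∘ σ) 1 = l 2 := by simp [hσ]
    have h2 : (l ∘ σ) 2 = l 1 := by simp [hσ]
    rw [h0, h1, h2] at key
    intro h; apply key
    linear_combination h
  rw [not_ne_iff] at hd
  -- `d' = e' = 0`: a binary form in `y₁ = λ₁ − sλ₀`, `y₂ = λ₂ − tλ₀`
  have hvC : (a : ℂ) + b * s ^ 2 + c * t ^ 2 + d * s + e * t + f * (s * t) = 0 := by
    exact_mod_cast hv
  have heC : (e : ℂ) + f * s + 2 * c * t = 0 := by exact_mod_cast he
  have hdC : (d : ℂ) + f * t + 2 * b * s = 0 := by exact_mod_cast hd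
  have hI : (a : ℂ) * l 0 ^ 2 + b * l 1 ^ 2 + c * l 2 ^ 2 + d * (l 0 * l 1) + e * (l 0 * l 2) +
      f * (l 1 * l 2) = b * (l 1 - s * l 0) ^ 2 + f * ((l 1 - s * l 0) * (l 2 - t * l 0)) +
        c * (l 2 - t * l 0) ^ 2 := by
    linear_combination (l 0) ^ 2 * hvC + (l 0 * (l 2 - t * l 0)) * heC +
      (l 0 * (l 1 - s * l 0)) * hdC
  rw [hI]
  have hbfc : ¬ (b = 0 ∧ f = 0 ∧ c = 0) := by
    rintro ⟨hb, hf, hc⟩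
    apply hne
    refine ⟨?_, hb, hc, ?_, ?_, hf⟩
    · rw [hb, hc, hf] at hv
      have hd0 : d = 0 := by rw [hf, hb] at hd; simpa using hd
      have he0 : e = 0 := by rw [hf, hc] at he; simpa using he
      rw [hd0, he0] at hv
      simpa using hv
    · rw [hf, hb] at hd; simpa using hd
    · rw [hf, hc] at he; simpa using he
  obtain ⟨A, B, hA, hB, hA0, hB0, hsplit⟩ := exists_split_binary b f c hbfc
  rw [hsplit]
  -- the two factors as linear forms in `λ` with algebraic coefficients
  have hK : ∀ x : ℚ, (x : ℂ) ∈ algebraicClosure ℚ ℂ := fun x =>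
    mem_algebraicClosure_iff.2 (isAlgebraic_ratCast x)
  have hAK : ∀ i, A i ∈ algebraicClosure ℚ ℂ := fun i => mem_algebraicClosure_iff.2 (hA i)
  have hBK : ∀ i, B i ∈ algebraicClosure ℚ ℂ := fun i => mem_algebraicClosure_iff.2 (hB i)
  have eA : A 0 * (l 1 - s * l 0) + A 1 * (l 2 - t * l 0) =
      ∑ k, (![-(A 0 * s + A 1 * t), A 0, A 1] : Fin 3 → ℂ) k * l k := by
    simp [Fin.sum_univ_three]; ring
  have eB : B 0 * (l 1 - s * l 0) + B 1 * (l 2 - t * l 0) =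
      ∑ k, (![-(B 0 * s + B 1 * t), B 0, B 1] : Fin 3 → ℂ) k * l k := by
    simp [Fin.sum_univ_three]; ring
  rw [eA, eB]
  refine sum_mul_sum_ne_zero hl hli ?_ ?_ ?_ ?_
  · intro i; fin_cases i
    · simpa using mem_algebraicClosure_iff.1
        (neg_mem (add_mem (mul_mem (hAK 0) (hK s)) (mul_mem (hAK 1) (hK t))))
    · simpa using hA 0
    · simpa using hA 1
  · intro i; fin_cases i
    · simpa using mem_algebraicClosure_iff.1
        (neg_mem (add_mem (mul_mem (hBK 0) (hK s)) (mul_mem (hBK 1) (hK t))))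
    · simpa using hB 0
    · simpa using hB 1
  · intro hz
    apply hA0
    funext i
    fin_cases i
    · simpa using congrFun hz 1
    · simpa using congrFun hz 2
  · intro hz
    apply hB0
    funext i
    fin_cases i
    · simpa using congrFun hz 1
    · simpa using congrFun hz 2

/-- The ternary case through any rational zero `v` with `v₀ ≠ 0` (rescale to `(1, s, t)`).
[cite: RoyWaldschmidt1997ENS, Résumé p. 753; Théorème 0.1 (d = ℓ = 2) p. 755] -/
theorem ternary_core_v (a b c d e f : ℚ) (v : Fin 3 → ℚ) (hv0 : v 0 ≠ 0)
    (hv : a * v 0 ^ 2 + b * v 1 ^ 2 + c * v 2 ^ 2 + d * (v 0 * v 1) + e * (v 0 * v 2) +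
      f * (v 1 * v 2) = 0)
    (hne : ¬ (a = 0 ∧ b = 0 ∧ c = 0 ∧ d = 0 ∧ e = 0 ∧ f = 0))
    {l : Fin 3 → ℂ} (hl : ∀ i, IsAlgebraic ℚ (cexp (l i))) (hli : LinearIndependent ℚ l)
    (ht : ¬ (2 : Cardinal) ≤ Algebra.trdeg ℚ ↥(adjoin ℚ (Set.range l))) :
    (a : ℂ) * l 0 ^ 2 + b * l 1 ^ 2 + c * l 2 ^ 2 + d * (l 0 * l 1) + e * (l 0 * l 2) +
      f * (l 1 * l 2) ≠ 0 := by
  refine ternary_core a b c d e f (v 1 / v 0) (v 2 / v 0) ?_ hne hl hli ht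
  have h : a + b * (v 1 / v 0) ^ 2 + c * (v 2 / v 0) ^ 2 + d * (v 1 / v 0) + e * (v 2 / v 0) +
      f * (v 1 / v 0 * (v 2 / v 0)) =
      (a * v 0 ^ 2 + b * v 1 ^ 2 + c * v 2 ^ 2 + d * (v 0 * v 1) + e * (v 0 * v 2) +
        f * (v 1 * v 2)) / v 0 ^ 2 := by
    field_simp
  rw [h, hv, zero_div]

/-! ### The Résumé corollary for isotropic ternary forms -/

/-- **Quadratic relations `Q(λ₀, λ₁, λ₂) = 0` with `Q` isotropic over `ℚ` are impossible in
transcendence degree `≤ 1` (PROVED).** Let `λ₀, λ₁, λ₂` be `ℚ`-linearly independent logarithms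
of algebraic numbers with `trdeg_ℚ ℚ(λ₀, λ₁, λ₂) ≤ 1`, and let `Q ∈ ℚ[X₀, X₁, X₂]` be a non-zero
quadratic form with a non-trivial rational zero `v`. Then `Q(λ) ≠ 0`. (The case `d = ℓ = 2` of
Roy–Waldschmidt's Théorème 0.1 — Brownawell–Waldschmidt — together with Baker's theorem; the
anisotropic ternary forms are the first case needing Théorème 0.2 itself.)
[cite: RoyWaldschmidt1997ENS, Résumé p. 753; Théorème 0.1 (d = ℓ = 2) and Théorème 0.2, p. 755]
[cite: RoyWaldschmidt1995, Theorem 1] [cite: Baker1975, Thm 2.1] -/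
theorem quadraticForm_ne_zero_three_of_isotropic (l : Fin 3 → ℂ)
    (hl : ∀ i, IsAlgebraic ℚ (cexp (l i))) (hli : LinearIndependent ℚ l)
    (ht : ¬ (2 : Cardinal) ≤ Algebra.trdeg ℚ ↥(adjoin ℚ (Set.range l)))
    (Q : MvPolynomial (Fin 3) ℚ) (hQ : Q.IsHomogeneous 2) (hQ0 : Q ≠ 0)
    (v : Fin 3 → ℚ) (hv0 : v ≠ 0) (hQv : MvPolynomial.eval v Q = 0) :
    aeval l Q ≠ 0 := by
  -- the six coefficients
  have hC : ∀ z : Fin 3 → ℂ, aeval z Q =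
      ((Q.coeff (Finsupp.single 0 2) : ℚ) : ℂ) * z 0 ^ 2 +
      ((Q.coeff (Finsupp.single 1 2) : ℚ) : ℂ) * z 1 ^ 2 +
      ((Q.coeff (Finsupp.single 2 2) : ℚ) : ℂ) * z 2 ^ 2 +
      ((Q.coeff (Finsupp.single 0 1 + Finsupp.single 1 1) : ℚ) : ℂ) * (z 0 * z 1) +
      ((Q.coeff (Finsupp.single 0 1 + Finsupp.single 2 1) : ℚ) : ℂ) * (z 0 * z 2) +
      ((Q.coeff (Finsupp.single 1 1 + Finsupp.single 2 1) : ℚ) : ℂ) * (z 1 * z 2) := fun z => by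
    rw [aeval_eq_of_isHomogeneous_two_three Q hQ z]
    simp
  have hQvC : aeval (fun i => ((v i : ℚ) : ℂ)) Q = 0 := by
    have e : (fun i => ((v i : ℚ) : ℂ)) = algebraMap ℚ ℂ ∘ v := by
      funext i; simp
    rw [e, MvPolynomial.aeval_algebraMap_eq_zero_iff_of_injective (B := ℂ)
      (algebraMap ℚ ℂ).injective]
    simpa using hQv
  have hQv' : Q.coeff (Finsupp.single 0 2) * v 0 ^ 2 + Q.coeff (Finsupp.single 1 2) * v 1 ^ 2 +
      Q.coeff (Finsupp.single 2 2) * v 2 ^ 2 +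
      Q.coeff (Finsupp.single 0 1 + Finsupp.single 1 1) * (v 0 * v 1) +
      Q.coeff (Finsupp.single 0 1 + Finsupp.single 2 1) * (v 0 * v 2) +
      Q.coeff (Finsupp.single 1 1 + Finsupp.single 2 1) * (v 1 * v 2) = 0 := by
    have h := hC (fun i => ((v i : ℚ) : ℂ))
    rw [hQvC] at h
    exact_mod_cast h.symm
  set a : ℚ := Q.coeff (Finsupp.single 0 2) with ha
  set b : ℚ := Q.coeff (Finsupp.single 1 2) with hb
  set c : ℚ := Q.coeff (Finsupp.single 2 2) with hc
  set d : ℚ := Q.coeff (Finsupp.single 0 1 + Finsupp.single 1 1) with hd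
  set e : ℚ := Q.coeff (Finsupp.single 0 1 + Finsupp.single 2 1) with he
  set f : ℚ := Q.coeff (Finsupp.single 1 1 + Finsupp.single 2 1) with hf
  have hne : ¬ (a = 0 ∧ b = 0 ∧ c = 0 ∧ d = 0 ∧ e = 0 ∧ f = 0) := by
    rintro ⟨h1, h2, h3, h4, h5, h6⟩
    apply hQ0
    refine eq_zero_of_forall_aeval_cast_eq_zero fun w => ?_
    rw [hC]
    simp [h1, h2, h3, h4, h5, h6]
  rw [hC]
  by_cases h0 : v 0 ≠ 0
  · exact ternary_core_v a b c d e f v h0 hQv' hne hl hli ht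
  rw [not_ne_iff] at h0
  by_cases h1 : v 1 ≠ 0
  · -- swap the coordinates `0` and `1`
    set σ : Equiv.Perm (Fin 3) := Equiv.swap 0 1 with hσ
    have hl' : ∀ i, IsAlgebraic ℚ (cexp ((l ∘ σ) i)) := fun i => hl _
    have hli' : LinearIndependent ℚ (l ∘ σ) := hli.comp _ σ.injective
    have ht' : ¬ (2 : Cardinal) ≤ Algebra.trdeg ℚ ↥(adjoin ℚ (Set.range (l ∘ σ))) := by
      rwa [σ.surjective.range_comp]
    have key := ternary_core_v b a c d f e ![v 1, v 0, v 2] (by simpa using h1)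
      (by simp; linear_combination hQv') (by tauto) hl' hli' ht'
    have e0 : (l ∘ σ) 0 = l 1 := by simp [hσ]
    have e1 : (l ∘ σ) 1 = l 0 := by simp [hσ]
    have e2 : (l ∘ σ) 2 = l 2 := by simp [hσ, Equiv.swap_apply_of_ne_of_ne]
    rw [e0, e1, e2] at key
    intro h; apply key
    linear_combination h
  rw [not_ne_iff] at h1
  by_cases h2 : v 2 ≠ 0
  · -- swap the coordinates `0` and `2`
    set σ : Equiv.Perm (Fin 3) := Equiv.swap 0 2 with hσ
    have hl' : ∀ i, IsAlgebraic ℚ (cexp ((l ∘ σ) i)) := fun i => hl _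
    have hli' : LinearIndependent ℚ (l ∘ σ) := hli.comp _ σ.injective
    have ht' : ¬ (2 : Cardinal) ≤ Algebra.trdeg ℚ ↥(adjoin ℚ (Set.range (l ∘ σ))) := by
      rwa [σ.surjective.range_comp]
    have key := ternary_core_v c b a f e d ![v 2, v 1, v 0] (by simpa using h2)
      (by simp; linear_combination hQv') (by tauto) hl' hli' ht'
    have e0 : (l ∘ σ) 0 = l 2 := by simp [hσ]
    have e1 : (l ∘ σ) 1 = l 1 := by simp [hσ, Equiv.swap_apply_of_ne_of_ne]
    have e2 : (l ∘ σ) 2 = l 0 := by simp [hσ]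
    rw [e0, e1, e2] at key
    intro h; apply key
    linear_combination h
  rw [not_ne_iff] at h2
  exact absurd (_root_.funext fun i => by fin_cases i <;> assumption) hv0

/-- **The instance of the named fact `royWaldschmidt_quadraticForm_ne_zero_of_trdeg_one` at
`n = 3` for forms isotropic over `ℚ`, PROVED** (with its hypothesis `trdeg = 1`).
[cite: RoyWaldschmidt1997ENS, Résumé p. 753] -/
theorem royWaldschmidt_quadraticForm_ne_zero_of_trdeg_one_three_of_isotropic (l : Fin 3 → ℂ)
    (hl : ∀ i, IsAlgebraic ℚ (cexp (l i))) (hli : LinearIndependent ℚ l)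
    (ht : Algebra.trdeg ℚ ↥(adjoin ℚ (Set.range l)) = 1)
    (Q : MvPolynomial (Fin 3) ℚ) (hQ : Q.IsHomogeneous 2) (hQ0 : Q ≠ 0)
    (hiso : ∃ v : Fin 3 → ℚ, v ≠ 0 ∧ MvPolynomial.eval v Q = 0) :
    aeval l Q ≠ 0 := by
  obtain ⟨v, hv0, hQv⟩ := hiso
  have ht' : ¬ (2 : Cardinal) ≤ Algebra.trdeg ℚ ↥(adjoin ℚ (Set.range l)) := by
    rw [ht]
    exact Nat.not_ofNat_le_one
  exact quadraticForm_ne_zero_three_of_isotropic l hl hli ht' Q hQ hQ0 v hv0 hQv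

/-! ### Real forms (the shape of the route items `RealGP3` / `AnisotropicPDQ21`, isotropic classes) -/

/-- **Real form, PROVED in transcendence degree `≤ 1`**: three `ℚ`-linearly independent real
logarithms of (real, positive) algebraic numbers `x₀, x₁, x₂` with `trdeg_ℚ ℚ(x) ≤ 1` satisfy
`Q(x) ≠ 0` for every non-zero ternary quadratic form `Q ∈ ℚ[X]` with a non-trivial rational zero.
[cite: RoyWaldschmidt1997ENS, Résumé p. 753; Théorème 0.1 (d = ℓ = 2) p. 755]
[cite: RoyWaldschmidt1995, Theorem 1] -/
theorem real_quadraticForm_ne_zero_three_of_isotropic (x : Fin 3 → ℝ) (hx : LinearIndependent ℚ x)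
    (halg : ∀ i, IsAlgebraic ℚ (Real.exp (x i)))
    (ht : ¬ (2 : Cardinal) ≤ Algebra.trdeg ℚ ↥(adjoin ℚ (Set.range fun i => (x i : ℂ))))
    (Q : MvPolynomial (Fin 3) ℚ) (hQ : Q.IsHomogeneous 2) (hQ0 : Q ≠ 0)
    (v : Fin 3 → ℚ) (hv0 : v ≠ 0) (hQv : MvPolynomial.eval v Q = 0) :
    aeval x Q ≠ 0 := by
  have hl : ∀ i, IsAlgebraic ℚ (cexp (x i : ℂ)) := fun i => by
    rw [← Complex.ofReal_exp]
    simpa using (halg i).algebraMap (A := ℂ)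
  have hli : LinearIndependent ℚ (fun i => (x i : ℂ)) := by
    refine Fintype.linearIndependent_iff.mpr fun g hg => ?_
    refine Fintype.linearIndependent_iff.mp hx g ?_
    apply Complex.ofReal_injective
    push_cast
    simpa [Rat.smul_def] using hg
  have key := quadraticForm_ne_zero_three_of_isotropic (fun i => (x i : ℂ)) hl hli ht Q hQ hQ0 v
    hv0 hQv
  intro h
  apply key
  have e : (fun i => (x i : ℂ)) = algebraMap ℝ ℂ ∘ x := by
    funext i; rfl
  rw [e, MvPolynomial.aeval_algebraMap_apply, h, map_zero]

/-- **`x² + D w² ≠ C z²` on the `ℚ`-isotropic classes, PROVED in transcendence degree `≤ 1`** (the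
shape of the route item `Summit.Schanuel.Schanuel.Theses.GeodesicLengthsGP3.AnisotropicPDQ21`,
restricted to the classes `⟨1, D, −C⟩` WITH a non-trivial rational zero `p² + D q² = C r²`, and
under the extra hypothesis `trdeg_ℚ ℚ(x, w, z) ≤ 1`): if `x, w, z` are `ℚ`-linearly independent real
logarithms of algebraic numbers generating a field of transcendence degree `≤ 1`, then
`x² + D w² ≠ C z²`. [cite: RoyWaldschmidt1997ENS, Résumé p. 753; Théorème 0.1 (d = ℓ = 2) p. 755]
[cite: RoyWaldschmidt1995, Theorem 1] -/
theorem sq_add_mul_sq_ne_mul_sq_of_isotropic_of_trdeg_le_one (D C : ℚ) (p q r : ℚ)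
    (hpqr : ¬ (p = 0 ∧ q = 0 ∧ r = 0)) (hzero : p ^ 2 + D * q ^ 2 = C * r ^ 2)
    (x : Fin 3 → ℝ) (hx : LinearIndependent ℚ x) (halg : ∀ i, IsAlgebraic ℚ (Real.exp (x i)))
    (ht : ¬ (2 : Cardinal) ≤ Algebra.trdeg ℚ ↥(adjoin ℚ (Set.range fun i => (x i : ℂ)))) :
    x 0 ^ 2 + D * x 1 ^ 2 ≠ C * x 2 ^ 2 := by
  set Q : MvPolynomial (Fin 3) ℚ := X 0 ^ 2 + MvPolynomial.C D * X 1 ^ 2 -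
    MvPolynomial.C C * X 2 ^ 2 with hQdef
  have hQ : Q.IsHomogeneous 2 := by
    refine ((isHomogeneous_X ℚ (0 : Fin 3)).pow 2).add (((isHomogeneous_X ℚ (1 : Fin 3)).pow 2).C_mul D)
      |>.sub (((isHomogeneous_X ℚ (2 : Fin 3)).pow 2).C_mul C)
  have hQeval : ∀ {A : Type} [CommRing A] [Algebra ℚ A] (z : Fin 3 → A),
      aeval z Q = z 0 ^ 2 + algebraMap ℚ A D * z 1 ^ 2 - algebraMap ℚ A C * z 2 ^ 2 := by
    intro A _ _ z
    simp [hQdef]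
  have hQ0 : Q ≠ 0 := by
    intro h0
    have h1 := hQeval (![1, 0, 0] : Fin 3 → ℚ)
    rw [h0, map_zero] at h1
    simp only [Matrix.cons_val_zero, Matrix.cons_val_one, Matrix.cons_val] at h1
    norm_num at h1
  have hQv : MvPolynomial.eval ![p, q, r] Q = 0 := by
    simp only [hQdef, map_sub, map_add, map_mul, map_pow, MvPolynomial.eval_X, MvPolynomial.eval_C,
      Matrix.cons_val_zero, Matrix.cons_val_one, Matrix.cons_val]
    linear_combination hzero
  have hv0 : (![p, q, r] : Fin 3 → ℚ) ≠ 0 := by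
    intro h0
    apply hpqr
    exact ⟨by simpa using congrFun h0 0, by simpa using congrFun h0 1, by simpa using congrFun h0 2⟩
  have key := real_quadraticForm_ne_zero_three_of_isotropic x hx halg ht Q hQ hQ0 _ hv0 hQv
  intro h
  apply key
  rw [hQeval]
  simp only [Algebra.algebraMap_eq_smul_one, Rat.smul_one_eq_cast]
  linear_combination h

end RoyWaldschmidt1997

end Literature.NumberTheory.Transcendental
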